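/-
Copyright (c) 2026 the pub-hodgecm-mathlib formalisation cell (harness21).  Prover seat hodgecm-mathlib-K2Liu-p09 (g2): Track B «K2-LIT»,
#184♮ = hLiu418 = stmt-HodgeConjecture-24832, unit U5b «LOCAL SEAM OF s23», socket #29s `sig_K2LiuDoublingPartialEuler`, file (B):
matrix coefficients on a compact automorphic quotient are continuous and bounded; 2026-09-04.
-/
import Literature.NumberTheory.K2Lit.DoublingZetaIntegral
import Mathlib.MeasureTheory.Integral.Bochner.Basic
import Mathlib.Analysis.Normed.Group.Bounded
import HarnessLib

/-!
# Crux `HLiu418`, Track B road `K2_Liu`, unit U5b «LOCAL SEAM OF s23», socket #29s — file (B):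
# CONTINUITY AND BOUNDEDNESS OF THE MATRIX COEFFICIENT `g ↦ ⟨π(g)φ₁, φ₂⟩` ON A COMPACT AUTOMORPHIC QUOTIENT

Cell `hodgecm-mathlib`, crux item hLiu418 = `stmt-HodgeConjecture-24832`; squad K2 ∕ K2Liu, prover K2Liu-p09 (g2).  THEOREMS ONLY; lane
`--supports stmt-HodgeConjecture-24832` (helper for socket #29s `sig_K2LiuDoublingPartialEuler` of
`Cruxes/HLiu418/Lines/K2_Liu_CurveThetaSigs_U5b_LocalSeam.lean`: its `φ₁ φ₂` are CONTINUOUS functions on a COMPACT quotient `[G]` and every Fubini of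
the proof needs the factor `Q(g) = ⟨π(g)φ₁, φ₂⟩` = ★ `quotMatrixCoeff 𝒢 μ φ₁ φ₂ g` to be bounded and (strongly) measurable in `g`).

THE STATEMENTS.  `𝒢 : AdelicGroupData K`, `μ` a finite measure on the automorphic quotient `[G] = G(𝔸) ⧸ A_G G(K)` (Borel σ-algebra, ★ instance), `φ₁ φ₂ : [G] → ℂ`
continuous, `[G]` compact.
* `exists_norm_le_of_continuous` — a continuous function on the compact quotient is bounded;
* `norm_quotMatrixCoeff_le` ∕ `exists_norm_quotMatrixCoeff_le` — `‖⟨π(g)φ₁, φ₂⟩‖ ≤ C₁ C₂ μ[G]` uniformly in `g`;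
* `continuous_quotMatrixCoeff` — `g ↦ ⟨π(g)φ₁, φ₂⟩` is continuous on `G(𝔸)` (dominated convergence, Mathlib `continuous_of_dominated`; the action
  `G(𝔸) × [G] → [G]` is jointly continuous, ★ `instContinuousSMulAutomorphicQuotient`), for first-countable `G(𝔸)` (the unitary groups of the tree are
  second countable);
* `measurable_quotMatrixCoeff` — hence Borel measurable.
[Borel–Jacquet (1979) §4.6; Liu (2021) §B.3 (B.7).]

HONEST LABEL.  Helper of socket #29s; by itself it retires no named input: `HC_CM` is proved only modulo the 7 printed citations (2 remaining named
inputs: hLiu418 = `stmt-HodgeConjecture-24832`, h413 = `stmt-HodgeConjecture-24833`) until rung 0 closes.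
-/

set_option autoImplicit false
-- the mandated namespace repeats the single-problem summit's segment (`HodgeConjecture.HodgeConjecture`)
set_option linter.dupNamespace false

noncomputable section

open scoped ENNReal NNReal
open NumberField MeasureTheory

namespace Summit.HodgeConjecture.HodgeConjecture.Cruxes.HLiu418.K2LiuQuotMatrixCoeffContinuous

open Literature.NumberTheory.Automorphic
open Literature.NumberTheory.K2Lit.SiegelDoubled

variable {K : Type} [Field K] [NumberField K] (𝒢 : AdelicGroupData.{0} K)
  (μ : Measure 𝒢.automorphicQuotient)

/-- A continuous function on the compact automorphic quotient is bounded. [cite: BorelJacquet1979, §4.6] -/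
theorem exists_norm_le_of_continuous [CompactSpace 𝒢.automorphicQuotient] {φ : 𝒢.automorphicQuotient → ℂ} (hφ : Continuous φ) :
    ∃ C : ℝ, 0 ≤ C ∧ ∀ x, ‖φ x‖ ≤ C := by
  obtain ⟨C, hC⟩ := isCompact_univ.exists_bound_of_continuousOn hφ.continuousOn
  exact ⟨max C 0, le_max_right _ _, fun x => (hC x (Set.mem_univ x)).trans (le_max_left _ _)⟩

/-- The integrand of the matrix coefficient is pointwise bounded: `‖φ₁(g⁻¹•x) conj(φ₂ x)‖ ≤ C₁ C₂`. [cite: Liu2021, §B.3 (B.7) p. 101] -/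
theorem norm_integrand_le {φ₁ φ₂ : 𝒢.automorphicQuotient → ℂ} {C₁ C₂ : ℝ} (hC₁ : 0 ≤ C₁)
    (h₁ : ∀ x, ‖φ₁ x‖ ≤ C₁) (h₂ : ∀ x, ‖φ₂ x‖ ≤ C₂) (g : 𝒢.Adelic) (x : 𝒢.automorphicQuotient) :
    ‖φ₁ (g⁻¹ • x) * starRingEnd ℂ (φ₂ x)‖ ≤ C₁ * C₂ := by
  rw [norm_mul, Complex.norm_conj]
  exact mul_le_mul (h₁ _) (h₂ _) (norm_nonneg _) hC₁

/-- **Uniform bound** `‖⟨π(g)φ₁, φ₂⟩‖ ≤ C₁ · C₂ · μ[G]` for bounded `φ₁, φ₂` and a finite measure `μ` (no measurability needed: if the integrand is not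
integrable the Bochner integral is `0`). [cite: BorelJacquet1979, §4.6] [cite: Liu2021, §B.3 (B.7) p. 101] -/
theorem norm_quotMatrixCoeff_le [IsFiniteMeasure μ] {φ₁ φ₂ : 𝒢.automorphicQuotient → ℂ} {C₁ C₂ : ℝ} (hC₁ : 0 ≤ C₁)
    (h₁ : ∀ x, ‖φ₁ x‖ ≤ C₁) (h₂ : ∀ x, ‖φ₂ x‖ ≤ C₂) (g : 𝒢.Adelic) :
    ‖quotMatrixCoeff 𝒢 μ φ₁ φ₂ g‖ ≤ C₁ * C₂ * μ.real Set.univ := by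
  unfold quotMatrixCoeff
  exact norm_integral_le_of_norm_le_const (Filter.Eventually.of_forall fun x => norm_integrand_le 𝒢 hC₁ h₁ h₂ g x)

/-- **The matrix coefficient of continuous functions on a compact quotient is bounded in `g`.** [cite: BorelJacquet1979, §4.6] -/
theorem exists_norm_quotMatrixCoeff_le [IsFiniteMeasure μ] [CompactSpace 𝒢.automorphicQuotient]
    {φ₁ φ₂ : 𝒢.automorphicQuotient → ℂ} (hφ₁ : Continuous φ₁) (hφ₂ : Continuous φ₂) :
    ∃ C : ℝ, ∀ g : 𝒢.Adelic, ‖quotMatrixCoeff 𝒢 μ φ₁ φ₂ g‖ ≤ C := by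
  obtain ⟨C₁, hC₁, h₁⟩ := exists_norm_le_of_continuous 𝒢 hφ₁
  obtain ⟨C₂, -, h₂⟩ := exists_norm_le_of_continuous 𝒢 hφ₂
  exact ⟨C₁ * C₂ * μ.real Set.univ, fun g => norm_quotMatrixCoeff_le 𝒢 μ hC₁ h₁ h₂ g⟩

/-- **CONTINUITY OF THE MATRIX COEFFICIENT `g ↦ ⟨π(g)φ₁, φ₂⟩ = ∫ φ₁(g⁻¹•x) conj(φ₂ x) dμ(x)`** for continuous `φ₁, φ₂` on a compact automorphic quotient, a finite
measure `μ`, and a first-countable group of adelic points: dominated convergence (Mathlib `continuous_of_dominated`) with the constant dominator `C₁ C₂`, the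
integrand being continuous in `g` for each `x` by the joint continuity of the action. [cite: BorelJacquet1979, §4.6] [cite: Liu2021, §B.3 (B.7) p. 101] -/
theorem continuous_quotMatrixCoeff [IsFiniteMeasure μ] [CompactSpace 𝒢.automorphicQuotient] [FirstCountableTopology 𝒢.Adelic]
    {φ₁ φ₂ : 𝒢.automorphicQuotient → ℂ} (hφ₁ : Continuous φ₁) (hφ₂ : Continuous φ₂) :
    Continuous (quotMatrixCoeff 𝒢 μ φ₁ φ₂) := by
  obtain ⟨C₁, hC₁, h₁⟩ := exists_norm_le_of_continuous 𝒢 hφ₁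
  obtain ⟨C₂, -, h₂⟩ := exists_norm_le_of_continuous 𝒢 hφ₂
  have hF : ∀ g : 𝒢.Adelic, Continuous fun x : 𝒢.automorphicQuotient => φ₁ (g⁻¹ • x) * starRingEnd ℂ (φ₂ x) := fun g =>
    (hφ₁.comp (continuous_const_smul g⁻¹)).mul (Complex.continuous_conj.comp hφ₂)
  show Continuous fun g : 𝒢.Adelic => ∫ x, φ₁ (g⁻¹ • x) * starRingEnd ℂ (φ₂ x) ∂μ
  refine continuous_of_dominated (bound := fun _ => C₁ * C₂) (fun g => (hF g).aestronglyMeasurable)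
    (fun g => Filter.Eventually.of_forall fun x => norm_integrand_le 𝒢 hC₁ h₁ h₂ g x) (integrable_const _)
    (Filter.Eventually.of_forall fun x => ?_)
  exact ((hφ₁.comp ((continuous_inv.smul continuous_const))).mul continuous_const)

/-- … hence the matrix coefficient is Borel measurable on `G(𝔸)`. [cite: BorelJacquet1979, §4.6] -/
theorem measurable_quotMatrixCoeff [IsFiniteMeasure μ] [CompactSpace 𝒢.automorphicQuotient] [FirstCountableTopology 𝒢.Adelic]
    [MeasurableSpace 𝒢.Adelic] [BorelSpace 𝒢.Adelic]
    {φ₁ φ₂ : 𝒢.automorphicQuotient → ℂ} (hφ₁ : Continuous φ₁) (hφ₂ : Continuous φ₂) :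
    Measurable (quotMatrixCoeff 𝒢 μ φ₁ φ₂) :=
  (continuous_quotMatrixCoeff 𝒢 μ hφ₁ hφ₂).measurable

end Summit.HodgeConjecture.HodgeConjecture.Cruxes.HLiu418.K2LiuQuotMatrixCoeffContinuous

end
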